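import Summits.ResolutionOfSingularities.ResolutionOfSingularities.Theorems.PurelyInseparableDim4ChartClosureDegree
import Summits.ResolutionOfSingularities.ResolutionOfSingularities.Theorems.PurelyInseparableDim4ChartCentreTwist
import Literature.AlgebraicGeometry.Resolution.CoordinateBlowupStrictTransformIdeal
import HarnessLib

/-!
# Purely inseparable four-folds `z^p + F(x₁, …, x₄)`: the escaping chart centre is the STRICT TRANSFORM
# of a GRAPH — ring level (brick S3-glob at depth 2, part A2; cell `res-dim4-pi`, typ-2 g4)

[OURS · counted 0] (D-0157 DOOR 2; director-resolution DR-157-C; desk WORD #97 (c); frame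
`PIDim4.TerminationImpliesOrderReduction`, S3 (c)). Setting of `…ChartCentreClosed` / `…ChartCentreEscape`:
`Θ` a re-centring automorphism of `K[z, x]` (`Θ z = z + h(x)`, `Θ xᵢ = xᵢ + bᵢ`, `b_j = 0`), `j ∈ S`,
`ψ = coordBlowupSubst K Λ_S x_j` the `x_j`-chart substitution of the blow-up of `𝔸⁵` along `V(z, x_S)`
(`Λ_S = {z} ∪ {xᵢ : i ∈ S}`), `S'` the next coordinate centre. NEW INPUT tying `Θ` to the walk: the
RING READING `Θ(ψ(z^p + F)) = x_j^p · (z^p + F₁)` of the chart dictionary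
(`exists_clean_translate_hyp_eq_step`, `F₁ = (step p S j b s).F`) and permissibility `p ≤ ord_{(x_{S'})} F₁`.
Write `G = h(σx)` for the TWISTED CLEANING POLYNOMIAL of `…ChartCentreTwist` (`σ_k = 0` on `S'`,
`x_k − b_k` off `S'`; it is the cleaning graph read in the chart coordinates and restricted to the next
centre) and `F' = chartTransform p S j F`. PROVED (no `sorry`, no new axiom):

* §1 `eq_pow_add_translate_of_reading` — the reading unpacks to `F₁ = h^p + F'(x + b)`;
  `twist_pow_add_aeval_const_eq_zero` — with permissibility of `S'`: **`G^p + F'(x_{S'} ↦ b_{S'}) = 0`**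
  (the restriction of `F'` to the shadow of the next centre is minus a `p`-th power, its root is `−G`).
* §2 `exists_lift_twist` — hence (A1's fibre bound: chart transform ⇒ constant substitution ⇒ `p`-th
  root ⇒ lift) there is a polynomial `H ∈ K[x]` with **`ψ_S(H) = x_j · G`**; `mem_span_X_of_lift` —
  such an `H` lies in `(xᵢ : i ∈ S)`.
* §3 THE GRAPH `Y = V(J_Y) ⊂ 𝔸⁵`, `J_Y = (z − H, x_k − b_k (k ∈ S' ∖ S), xᵢ − bᵢ x_j (i ∈ S' ∩ S))` — a graph
  over a linear space — and, for `j ∉ S'` (the next centre is not inside the new exceptional divisor):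
  **`map_clean_coordStrictTransformIdeal_graph`**: `Θ (J_Y^st) = (z, x_{S'})`, where `J_Y^st` is the tree's
  `coordStrictTransformIdeal K Λ_S x_j J_Y` (the `x_j`-saturation of `ψ(J_Y)`, Görtz–Wedhorn 13.96 (2)) —
  i.e. ON THE RE-CENTRED CHART THE STRICT TRANSFORM OF `Y` IS EXACTLY THE NEXT CENTRE `V(z, x_{S'})`;
  `graph_sup_IΛ` — `J_Y + (z, x_S) = (z, x_S) + (x_k − b_k : k ∈ S' ∖ S)`: the centre `V(z, x_S)` meets `Y`
  in a COORDINATE subspace of `Y`.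

With the scheme-level sequel (`…ChartClosureStrict`: `supp St_π(𝒥_Y) = closure φ(V(z, x_{S'}))`,
`St_π(𝒥_Y).subscheme = Bl_{Y ∩ C} Y` regular) this answers Q1 of the S3-glob question for `j ∉ S'`.
Instance of record (crit-3 K-A3-17, 𝔽₂, `F = x₁x₂(x₃+1)²x₄`, `S = {1,2}`, `j = 1`, `b₃ = 1`, `S' = {3}`):
`h = 0`, `G = 0`, `H = 0`, `Y = V(z, x₃ − 1)`; crit-3's T-A3-13 non-linear instance
(`F = (x₁x₂ + x₁x₃ + x₂x₄)²(x₃x₄ + x₃ + x₄)`, `S' = {3,4}`): `Y = V(z − (x₁ + x₂ + x₁x₂), x₃ − 1, x₄ − 1)` up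
to the sign conventions — a smooth NON-linear graph. Nothing here is a statement about resolution of
singularities in dimension ≥ 4 / characteristic `p` (NOT proved anywhere in this programme). bears_on:
LADDER-RESOLUTION:D157-DOOR2 (res-dim4-pi). Supports stmt-ResolutionOfSingularities-16155 (helper, S3-glob A2).
-/

-- every declaration of this summit lives under `Summit.ResolutionOfSingularities.ResolutionOfSingularities`
-- (summit = problem), which the duplicate-namespace linter flags; house convention (cf. the Target file).
set_option linter.dupNamespace false

noncomputable section

open MvPolynomial Finset

open scoped BigOperators

namespace Summit.ResolutionOfSingularities.ResolutionOfSingularities.Theorems.PIDim4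

open Literature.AlgebraicGeometry.Resolution
open Literature.AlgebraicGeometry.Resolution.AffinePointBlowup (A)
open Literature.RingTheory.MvPolynomial (ker_aeval_ite_eq_span isPrime_span_X_image X_mem_span_X_image_iff)

namespace ChartDictionary

variable {K : Type} [Field K] {p : ℕ} {S S' : Finset (Fin 4)} {j : Fin 4} {b : Fin 4 → K}
  {Θ : A 4 K ≃ₐ[K] A 4 K} {h : MvPolynomial (Fin 4) K} {F F₁ : MvPolynomial (Fin 4) K}

/-! ## §1 Unpacking the ring reading of the chart dictionary -/

/-- `Θ` acts on `z^q + G(x)` by `z ↦ z + h`, `x ↦ x + b`: in characteristic `p`,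
`Θ (z^p + G) = z^p + (h^p + G(x + b))`. -/
theorem clean_hyp_translate [hp : Fact p.Prime] [CharP K p] (h0 : Θ (X 0) = X 0 + rename Fin.succ h)
    (hs : ∀ i : Fin 4, Θ (X i.succ) = X i.succ + C (b i)) (G : MvPolynomial (Fin 4) K) :
    Θ (hyp p G) = hyp p (h ^ p + PointBlowup.translate b G) := by
  rw [hyp, hyp, map_add, map_pow, h0, clean_rename_eq_rename_aeval hs, add_pow_char, map_add, map_pow,
    add_assoc]
  rfl

/-- **The reading unpacked.** From `Θ(ψ(z^p + F)) = x_j^p (z^p + F₁)` (and permissibility of `S`, which makes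
`ψ(z^p + F) = x_j^p (z^p + F')`): `F₁ = h^p + F'(x + b)`, `F' = chartTransform p S j F`. -/
theorem eq_pow_add_translate_of_reading [Fact p.Prime] [CharP K p] (hj : j ∈ S) (hbj : b j = 0)
    (h0 : Θ (X 0) = X 0 + rename Fin.succ h) (hs : ∀ i : Fin 4, Θ (X i.succ) = X i.succ + C (b i))
    (hperm : (p : ℕ∞) ≤ CentreBlowup.ordAlong S F)
    (hread : Θ (coordBlowupSubst K (insert 0 (Fin.succ '' (S : Set (Fin 4)))) j.succ (hyp p F)) =
      X j.succ ^ p * hyp p F₁) :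
    F₁ = h ^ p + PointBlowup.translate b (CentreBlowup.chartTransform p S j F) := by
  rw [coordBlowupSubst_hyp p hj F hperm, map_mul, map_pow, hs j, hbj, C_0, add_zero,
    clean_hyp_translate h0 hs] at hread
  -- cancel `x_j^p`, then `z^p`, then the renaming (the tree's `Equimultiple.hyp_injective`, inlined)
  exact (rename_injective _ (Fin.succ_injective 4) (add_left_cancel (a := (X 0 : A 4 K) ^ p)
    (mul_left_cancel₀ (pow_ne_zero p (X_ne_zero _)) hread))).symm

/-- Permissibility of `S'` for `F₁` (`1 ≤ p ≤ ord_{(x_{S'})} F₁`) puts `F₁` in the ideal `(x_k : k ∈ S')`. -/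
theorem mem_span_X_of_le_ordAlong [hp : Fact p.Prime] (hperm' : (p : ℕ∞) ≤ CentreBlowup.ordAlong S' F₁) :
    F₁ ∈ Ideal.span (X '' (S' : Set (Fin 4)) : Set (MvPolynomial (Fin 4) K)) := by
  rw [mem_ideal_span_X_image]
  intro d hd
  have h1 : (p : ℕ∞) ≤ (CentreBlowup.degIn S' d : ℕ∞) := hperm'.trans (CentreBlowup.ordAlong_le_of_mem_support hd)
  have h2 : CentreBlowup.degIn S' d ≠ 0 := by
    have : p ≤ CentreBlowup.degIn S' d := by exact_mod_cast h1
    have := hp.out.one_lt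
    omega
  obtain ⟨i, hi, hne⟩ := Finset.exists_ne_zero_of_sum_ne_zero h2
  exact ⟨i, hi, hne⟩

/-- Killing-and-translating (`x_k ↦ 0` on `S'`, `x_k ↦ x_k − b_k` off `S'`) after translating by `b` is the
constant substitution `x_k ↦ b_k` (`k ∈ S'`). -/
theorem aeval_twist_translate (G : MvPolynomial (Fin 4) K) :
    aeval (fun k => if k ∈ S' then (0 : MvPolynomial (Fin 4) K) else X k - C (b k)) (PointBlowup.translate b G) =
      aeval (fun k => if k ∈ S' then C (b k) else (X k : MvPolynomial (Fin 4) K)) G := by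
  have hc : (aeval fun k => if k ∈ S' then (0 : MvPolynomial (Fin 4) K) else X k - C (b k)).comp
      (aeval fun k => (X k + C (b k) : MvPolynomial (Fin 4) K)) =
      aeval fun k => if k ∈ S' then C (b k) else (X k : MvPolynomial (Fin 4) K) := by
    refine MvPolynomial.algHom_ext fun k => ?_
    rw [AlgHom.comp_apply, aeval_X, aeval_X, map_add, aeval_X, aeval_C, algebraMap_eq]
    by_cases hk : k ∈ S'
    · rw [if_pos hk, if_pos hk, zero_add]
    · rw [if_neg hk, if_neg hk, sub_add_cancel]
  rw [← hc]
  rfl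

/-- Killing-and-translating kills the ideal `(x_k : k ∈ S')`. -/
theorem aeval_twist_eq_zero_of_mem {P : MvPolynomial (Fin 4) K}
    (hP : P ∈ Ideal.span (X '' (S' : Set (Fin 4)) : Set (MvPolynomial (Fin 4) K))) :
    aeval (fun k => if k ∈ S' then (0 : MvPolynomial (Fin 4) K) else X k - C (b k)) P = 0 := by
  rw [← RingHom.mem_ker]
  refine (Ideal.span_le.mpr ?_) hP
  rintro _ ⟨k, hk, rfl⟩
  rw [SetLike.mem_coe, RingHom.mem_ker]
  exact (aeval_X _ k).trans (if_pos (Finset.mem_coe.mp hk))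

/-- **The twisted cleaning polynomial is a `p`-th root.** With `G = h(σ x)` (`σ_k = 0` on `S'`, `x_k − b_k` off
`S'`) and the reading + permissibility of `S'`: `G^p + F'(x_k ↦ b_k, k ∈ S') = 0`. -/
theorem twist_pow_add_aeval_const_eq_zero [Fact p.Prime] [CharP K p] (hj : j ∈ S) (hbj : b j = 0)
    (h0 : Θ (X 0) = X 0 + rename Fin.succ h) (hs : ∀ i : Fin 4, Θ (X i.succ) = X i.succ + C (b i))
    (hperm : (p : ℕ∞) ≤ CentreBlowup.ordAlong S F)
    (hread : Θ (coordBlowupSubst K (insert 0 (Fin.succ '' (S : Set (Fin 4)))) j.succ (hyp p F)) =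
      X j.succ ^ p * hyp p F₁)
    (hperm' : (p : ℕ∞) ≤ CentreBlowup.ordAlong S' F₁) :
    aeval (fun k => if k ∈ S' then (0 : MvPolynomial (Fin 4) K) else X k - C (b k)) h ^ p +
      aeval (fun k => if k ∈ S' then C (b k) else (X k : MvPolynomial (Fin 4) K))
        (CentreBlowup.chartTransform p S j F) = 0 := by
  have h1 := aeval_twist_eq_zero_of_mem (b := b) (mem_span_X_of_le_ordAlong hperm')
  rw [eq_pow_add_translate_of_reading hj hbj h0 hs hperm hread, map_add, map_pow, aeval_twist_translate] at h1
  exact h1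

/-! ## §2 The lift `H`: `ψ_S(H) = x_j · G` -/

/-- **The lift exists.** Under the reading and the two permissibilities there is `H ∈ K[x]` with
`coordBlowupSubst K S j H = x_j · G` (`G` the twisted cleaning polynomial): by A1, `F'` has fibre bound `p`,
so has `F'(x_{S'} ↦ b_{S'})` (`b_j = 0`), so `G` — a `p`-th root of minus it — has fibre bound `1`, which is
polynomiality of `x_j · G(x_{S∖j}/x_j, …)`. -/
theorem exists_lift_twist [Fact p.Prime] [CharP K p] (hj : j ∈ S) (hbj : b j = 0)
    (h0 : Θ (X 0) = X 0 + rename Fin.succ h) (hs : ∀ i : Fin 4, Θ (X i.succ) = X i.succ + C (b i))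
    (hperm : (p : ℕ∞) ≤ CentreBlowup.ordAlong S F)
    (hread : Θ (coordBlowupSubst K (insert 0 (Fin.succ '' (S : Set (Fin 4)))) j.succ (hyp p F)) =
      X j.succ ^ p * hyp p F₁)
    (hperm' : (p : ℕ∞) ≤ CentreBlowup.ordAlong S' F₁) :
    ∃ H : MvPolynomial (Fin 4) K, coordBlowupSubst K (S : Set (Fin 4)) j H =
      X j * aeval (fun k => if k ∈ S' then (0 : MvPolynomial (Fin 4) K) else X k - C (b k)) h := by
  refine exists_coordBlowupSubst_eq_X_mul S j _ fun e he => ?_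
  have hrel := twist_pow_add_aeval_const_eq_zero hj hbj h0 hs hperm hread hperm'
  refine fibre_le_of_pow_char_eq p S j (eq_neg_of_add_eq_zero_left hrel) (fun d hd => ?_) he
  rw [support_neg] at hd
  exact fibre_le_of_mem_support_aeval_const p S S' j b (fun _ => hbj) _
    (fun d' hd' => fibre_le_of_mem_support_chartTransform p S j F hperm hd') hd

/-- A lift lies in the ideal of the centre variables: `ψ_S(H) = x_j · G ⇒ H ∈ (xᵢ : i ∈ S)` (kill the
variables of `S`: this kills `ψ_S(H)` exactly when it kills `H`, and it kills `x_j · G` as `j ∈ S`). -/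
theorem mem_span_X_of_lift (hj : j ∈ S) {H G : MvPolynomial (Fin 4) K}
    (hH : coordBlowupSubst K (S : Set (Fin 4)) j H = X j * G) :
    H ∈ Ideal.span (X '' (S : Set (Fin 4)) : Set (MvPolynomial (Fin 4) K)) := by
  classical
  have hc : (aeval fun i => if i ∈ (S : Set (Fin 4)) then (0 : MvPolynomial (Fin 4) K) else X i).comp
      (coordBlowupSubst K (S : Set (Fin 4)) j) =
      aeval fun i => if i ∈ (S : Set (Fin 4)) then (0 : MvPolynomial (Fin 4) K) else X i := by
    refine MvPolynomial.algHom_ext fun i => ?_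
    rw [AlgHom.comp_apply, coordBlowupSubst_X]
    by_cases hi : i ∈ (S : Set (Fin 4)) ∧ i ≠ j
    · rw [if_pos hi, map_mul, aeval_X, aeval_X, if_pos (Finset.mem_coe.mpr hj), zero_mul, if_pos hi.1]
    · rw [if_neg hi]
  rw [← ker_aeval_ite_eq_span, RingHom.mem_ker]
  change aeval _ H = 0
  rw [← congrArg (fun f : MvPolynomial (Fin 4) K →ₐ[K] MvPolynomial (Fin 4) K => f H) hc, AlgHom.comp_apply, hH,
    map_mul, aeval_X, if_pos (Finset.mem_coe.mpr hj), zero_mul]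

/-! ## §3 The graph `Y` and its strict transform on the re-centred chart -/

section Graph

/-- On the `x_j`-chart: `ψ(z − H(x)) = x_j · (z − G(x))` for a lift `ψ_S(H) = x_j G`. -/
theorem coordBlowupSubst_X_zero_sub_lift {H G : MvPolynomial (Fin 4) K}
    (hH : coordBlowupSubst K (S : Set (Fin 4)) j H = X j * G) :
    coordBlowupSubst K (insert 0 (Fin.succ '' (S : Set (Fin 4)))) j.succ (X 0 - rename Fin.succ H) =
      X j.succ * (X 0 - rename Fin.succ G) := by
  rw [map_sub, coordBlowupSubst_centreVars_X_zero, coordBlowupSubst_centreVars_rename, hH, map_mul, rename_X,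
    mul_sub]

/-- The re-centring reads `z − G` as `z + (h − h|_{x_{S'} = 0})`. -/
theorem clean_X_zero_sub_twist (h0 : Θ (X 0) = X 0 + rename Fin.succ h)
    (hs : ∀ i : Fin 4, Θ (X i.succ) = X i.succ + C (b i)) :
    Θ (X 0 - rename Fin.succ (aeval (fun k => if k ∈ S' then (0 : MvPolynomial (Fin 4) K) else X k - C (b k)) h)) =
      X 0 + rename Fin.succ (h - aeval (fun k => if k ∈ S' then (0 : MvPolynomial (Fin 4) K) else X k) h) := by
  rw [map_sub, h0, clean_rename_eq_rename_aeval hs, aeval_add_C_twist, map_sub]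
  ring

/-- On the `x_j`-chart: `ψ(x_k − b_k) = x_k − b_k` for a base variable `k ∉ S`. -/
theorem coordBlowupSubst_X_sub_C_of_not_mem {k : Fin 4} (hk : k ∉ S) :
    coordBlowupSubst K (insert 0 (Fin.succ '' (S : Set (Fin 4)))) j.succ (X k.succ - C (b k) : A 4 K) =
      X k.succ - C (b k) := by
  rw [map_sub, coordBlowupSubst_C, coordBlowupSubst_X_of_not_mem K _ j.succ
    (fun hm => hk ((succ_mem_centreVars_iff S k).mp hm))]

/-- On the `x_j`-chart: `ψ(xᵢ − bᵢ x_j) = x_j (xᵢ − bᵢ)` for a centre variable `i ∈ S ∖ j`. -/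
theorem coordBlowupSubst_X_sub_C_mul {i : Fin 4} (hi : i ∈ S) (hij : i ≠ j) :
    coordBlowupSubst K (insert 0 (Fin.succ '' (S : Set (Fin 4)))) j.succ (X i.succ - C (b i) * X j.succ : A 4 K) =
      X j.succ * (X i.succ - C (b i)) := by
  rw [map_sub, map_mul, coordBlowupSubst_C, coordBlowupSubst_X_self,
    coordBlowupSubst_X_of_mem_of_ne K _ j.succ (succ_mem_centreVars hi) (fun e => hij (Fin.succ_inj.mp e))]
  ring

/-- `x_j ∉ (z, x_{S'})` when `j ∉ S'`. -/
theorem X_succ_not_mem_IΛ (hjS' : j ∉ S') :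
    (X j.succ : A 4 K) ∉ AffineCoordBlowup.IΛ 4 K (insert 0 (Fin.succ '' (S' : Set (Fin 4)))) := by
  intro hmem
  have := (X_mem_span_X_image_iff (R := K)).mp hmem
  exact hjS' ((succ_mem_centreVars_iff S' j).mp this)

/-- **THE STRICT TRANSFORM OF THE GRAPH, READ ON THE RE-CENTRED CHART, IS THE NEXT CENTRE** (`j ∉ S'`). Let
`J_Y = (z − H, x_k − b_k (k ∈ S' ∖ S), xᵢ − bᵢ x_j (i ∈ S' ∩ S))` with `ψ_S(H) = x_j G`, `G = h(σx)` the twisted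
cleaning polynomial. Then `Θ` carries the `x_j`-saturation `J_Y^st = ⋃ₙ (ψ(J_Y) : x_jⁿ)` of the total transform
(the tree's `coordStrictTransformIdeal`, the ideal of the strict transform on the chart) onto `(z, x_{S'})`:
`Θ(J_Y^st) = 𝓘Λ_{S'}(⊤)`. -/
theorem map_clean_coordStrictTransformIdeal_graph (hjS' : j ∉ S') (hbj : b j = 0)
    (h0 : Θ (X 0) = X 0 + rename Fin.succ h) (hs : ∀ i : Fin 4, Θ (X i.succ) = X i.succ + C (b i))
    {H : MvPolynomial (Fin 4) K} (hH : coordBlowupSubst K (S : Set (Fin 4)) j H =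
      X j * aeval (fun k => if k ∈ S' then (0 : MvPolynomial (Fin 4) K) else X k - C (b k)) h) :
    (coordStrictTransformIdeal K (insert 0 (Fin.succ '' (S : Set (Fin 4)))) j.succ
      (Ideal.span (insert (X 0 - rename Fin.succ H)
        (((fun k : Fin 4 => (X k.succ - C (b k) : A 4 K)) '' ((S' \ S : Finset (Fin 4)) : Set (Fin 4))) ∪
         ((fun i : Fin 4 => (X i.succ - C (b i) * X j.succ : A 4 K)) '' ((S' ∩ S : Finset (Fin 4)) : Set (Fin 4))))))).map
      (Θ : A 4 K →+* A 4 K) =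
      AffineCoordBlowup.IΛ 4 K (insert 0 (Fin.succ '' (S' : Set (Fin 4)))) := by
  classical
  set Λ : Set (Fin (4 + 1)) := insert 0 (Fin.succ '' (S : Set (Fin 4))) with hΛ
  set Λ' : Set (Fin (4 + 1)) := insert 0 (Fin.succ '' (S' : Set (Fin 4))) with hΛ'
  set Gt := aeval (fun k => if k ∈ S' then (0 : MvPolynomial (Fin 4) K) else X k - C (b k)) h with hGt
  set gens : Set (A 4 K) := insert (X 0 - rename Fin.succ H)
        (((fun k : Fin 4 => (X k.succ - C (b k) : A 4 K)) '' ((S' \ S : Finset (Fin 4)) : Set (Fin 4))) ∪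
         ((fun i : Fin 4 => (X i.succ - C (b i) * X j.succ : A 4 K)) '' ((S' ∩ S : Finset (Fin 4)) : Set (Fin 4))))
    with hgens
  set sat := coordStrictTransformIdeal K Λ j.succ (Ideal.span gens) with hsat
  have hΘj : Θ (X j.succ) = X j.succ := by rw [hs j, hbj, C_0, add_zero]
  have hΘC : ∀ c : K, Θ (C c) = C c := fun c => Θ.commutes c
  have hprime : (AffineCoordBlowup.IΛ 4 K Λ').IsPrime := AffineCoordBlowup.isPrime_IΛ 4 K Λ'
  have hxj : (X j.succ : A 4 K) ∉ AffineCoordBlowup.IΛ 4 K Λ' := X_succ_not_mem_IΛ hjS'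
  -- `Θ ∘ ψ` carries every generator of `J_Y` into `(z, x_{S'})`
  have hgen : ∀ g ∈ gens, Θ (coordBlowupSubst K Λ j.succ g) ∈ AffineCoordBlowup.IΛ 4 K Λ' := by
    intro g hg
    rcases hg with rfl | ⟨k, hk, rfl⟩ | ⟨i, hi, rfl⟩
    · rw [coordBlowupSubst_X_zero_sub_lift hH, map_mul, hΘj, hGt, clean_X_zero_sub_twist h0 hs]
      exact Ideal.mul_mem_left _ _ (X_zero_add_rename_sub_mem_IΛ S' h)
    · obtain ⟨hkS', hkS⟩ := Finset.mem_sdiff.mp (Finset.mem_coe.mp hk)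
      rw [coordBlowupSubst_X_sub_C_of_not_mem hkS, map_sub, hs k, hΘC, add_sub_cancel_right]
      exact Ideal.subset_span ⟨k.succ, Set.mem_insert_of_mem _ ⟨k, hkS', rfl⟩, rfl⟩
    · obtain ⟨hiS', hiS⟩ := Finset.mem_inter.mp (Finset.mem_coe.mp hi)
      have hij : i ≠ j := fun e => hjS' (e ▸ hiS')
      rw [clean_subst_X_sub S hiS hij hbj hs]
      exact Ideal.mul_mem_left _ _ (Ideal.subset_span ⟨i.succ, Set.mem_insert_of_mem _ ⟨i, hiS', rfl⟩, rfl⟩)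
  have htot : ((Ideal.span gens).map (coordBlowupSubst K Λ j.succ : A 4 K →+* A 4 K)).map (Θ : A 4 K →+* A 4 K) ≤
      AffineCoordBlowup.IΛ 4 K Λ' := by
    rw [Ideal.map_map, Ideal.map_span, Ideal.span_le]
    rintro _ ⟨g, hg, rfl⟩
    exact hgen g hg
  apply le_antisymm
  · -- `Θ(J_Y^st) ⊆ (z, x_{S'})`: peel off the powers of `x_j` in the prime `(z, x_{S'}) ∌ x_j`
    rw [Ideal.map_le_iff_le_comap]
    rintro f ⟨N, hN⟩
    rw [Ideal.mem_comap]
    have h1 : (Θ : A 4 K →+* A 4 K) (X j.succ ^ N * f) ∈ AffineCoordBlowup.IΛ 4 K Λ' :=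
      htot (Ideal.mem_map_of_mem _ hN)
    rw [map_mul, map_pow, RingHom.coe_coe, hΘj] at h1
    rcases hprime.mem_or_mem h1 with h2 | h2
    · exact absurd (hprime.mem_of_pow_mem N h2) hxj
    · exact h2
  · -- `(z, x_{S'}) ⊆ Θ(J_Y^st)`: the generators `x_k` (`k ∈ S'`) and then `z`
    have hsatk : ∀ k ∈ S', (X k.succ - C (b k) : A 4 K) ∈ sat := by
      intro k hk
      by_cases hkS : k ∈ S
      · have hkj : k ≠ j := fun e => hjS' (e ▸ hk)
        refine mem_of_X_mul_mem K Λ j.succ ?_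
        rw [← coordBlowupSubst_X_sub_C_mul hkS hkj]
        exact coordBlowupSubst_mem K Λ j.succ (Ideal.subset_span (Set.mem_insert_of_mem _
          (Or.inr ⟨k, Finset.mem_coe.mpr (Finset.mem_inter.mpr ⟨hk, hkS⟩), rfl⟩)))
      · have h1 := coordBlowupSubst_mem K Λ j.succ (I := Ideal.span gens) (Ideal.subset_span
          (Set.mem_insert_of_mem _ (Or.inl ⟨k, Finset.mem_coe.mpr (Finset.mem_sdiff.mpr ⟨hk, hkS⟩), rfl⟩)))
        rwa [coordBlowupSubst_X_sub_C_of_not_mem hkS] at h1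
    have hXk : ∀ k ∈ S', (X k.succ : A 4 K) ∈ sat.map (Θ : A 4 K →+* A 4 K) := by
      intro k hk
      have h1 := Ideal.mem_map_of_mem (Θ : A 4 K →+* A 4 K) (hsatk k hk)
      rwa [map_sub, RingHom.coe_coe, hs k, hΘC, add_sub_cancel_right] at h1
    have hspan : (Ideal.span (X '' (S' : Set (Fin 4)) : Set (MvPolynomial (Fin 4) K))).map
        (rename Fin.succ : MvPolynomial (Fin 4) K →ₐ[K] A 4 K) ≤ sat.map (Θ : A 4 K →+* A 4 K) := by
      rw [Ideal.map_span, Ideal.span_le]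
      rintro _ ⟨_, ⟨k, hk, rfl⟩, rfl⟩
      rw [SetLike.mem_coe, rename_X]
      exact hXk k (Finset.mem_coe.mp hk)
    have hz : (X 0 : A 4 K) ∈ sat.map (Θ : A 4 K →+* A 4 K) := by
      have h1 : X 0 - rename Fin.succ Gt ∈ sat := by
        refine mem_of_X_mul_mem K Λ j.succ ?_
        rw [← coordBlowupSubst_X_zero_sub_lift hH]
        exact coordBlowupSubst_mem K Λ j.succ (Ideal.subset_span (Set.mem_insert _ _))
      have h2 := Ideal.mem_map_of_mem (Θ : A 4 K →+* A 4 K) h1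
      rw [RingHom.coe_coe, hGt, clean_X_zero_sub_twist h0 hs] at h2
      have h3 : rename Fin.succ (h - aeval (fun k => if k ∈ S' then (0 : MvPolynomial (Fin 4) K) else X k) h) ∈
          sat.map (Θ : A 4 K →+* A 4 K) :=
        hspan (Ideal.mem_map_of_mem _ (sub_aeval_mem_span_X_image S' h))
      have h5 := Ideal.sub_mem _ h2 h3
      rwa [add_sub_cancel_right] at h5
    rw [AffineCoordBlowup.IΛ, Ideal.span_le]
    rintro _ ⟨l, hl, rfl⟩
    rcases hl with rfl | ⟨k, hk, rfl⟩
    · exact hz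
    · exact hXk k (Finset.mem_coe.mp hk)

/-- **The centre meets the graph in a coordinate subspace of the graph**: with `H ∈ (xᵢ : i ∈ S)` (any lift,
`mem_span_X_of_lift`), `J_Y + (z, x_S) = (z, x_S) + (x_k − b_k : k ∈ S' ∖ S)`. -/
theorem graph_sup_IΛ (hj : j ∈ S) {H : MvPolynomial (Fin 4) K}
    (hHS : H ∈ Ideal.span (X '' (S : Set (Fin 4)) : Set (MvPolynomial (Fin 4) K))) :
    Ideal.span (insert (X 0 - rename Fin.succ H)
        (((fun k : Fin 4 => (X k.succ - C (b k) : A 4 K)) '' ((S' \ S : Finset (Fin 4)) : Set (Fin 4))) ∪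
         ((fun i : Fin 4 => (X i.succ - C (b i) * X j.succ : A 4 K)) '' ((S' ∩ S : Finset (Fin 4)) : Set (Fin 4))))) ⊔
      AffineCoordBlowup.IΛ 4 K (insert 0 (Fin.succ '' (S : Set (Fin 4)))) =
    AffineCoordBlowup.IΛ 4 K (insert 0 (Fin.succ '' (S : Set (Fin 4)))) ⊔
      Ideal.span ((fun k : Fin 4 => (X k.succ - C (b k) : A 4 K)) '' ((S' \ S : Finset (Fin 4)) : Set (Fin 4))) := by
  have hHΛ : rename Fin.succ H ∈ AffineCoordBlowup.IΛ 4 K (insert 0 (Fin.succ '' (S : Set (Fin 4)))) := by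
    have h4 := Ideal.mem_map_of_mem (rename Fin.succ : MvPolynomial (Fin 4) K →ₐ[K] A 4 K).toRingHom hHS
    rw [Ideal.map_span] at h4
    refine (Ideal.span_le.mpr ?_) h4
    rintro _ ⟨_, ⟨i, hi, rfl⟩, rfl⟩
    exact Ideal.subset_span ⟨i.succ, Set.mem_insert_of_mem _ ⟨i, hi, rfl⟩,
      by rw [AlgHom.toRingHom_eq_coe, RingHom.coe_coe, rename_X]⟩
  have hz : (X 0 : A 4 K) ∈ AffineCoordBlowup.IΛ 4 K (insert 0 (Fin.succ '' (S : Set (Fin 4)))) :=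
    Ideal.subset_span ⟨0, Set.mem_insert _ _, rfl⟩
  apply le_antisymm
  · rw [sup_le_iff]
    refine ⟨?_, le_sup_left⟩
    rw [Ideal.span_le]
    rintro g (rfl | ⟨k, hk, rfl⟩ | ⟨i, hi, rfl⟩)
    · exact Ideal.mem_sup_left (Ideal.sub_mem _ hz hHΛ)
    · exact Ideal.mem_sup_right (Ideal.subset_span ⟨k, hk, rfl⟩)
    · obtain ⟨-, hiS⟩ := Finset.mem_inter.mp (Finset.mem_coe.mp hi)
      refine Ideal.mem_sup_left (Ideal.sub_mem _ (Ideal.subset_span ⟨i.succ, Set.mem_insert_of_mem _ ⟨i, hiS, rfl⟩, rfl⟩)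
        (Ideal.mul_mem_left _ _ (Ideal.subset_span ⟨j.succ, Set.mem_insert_of_mem _ ⟨j, hj, rfl⟩, rfl⟩)))
  · rw [sup_le_iff]
    refine ⟨le_sup_right, ?_⟩
    rw [Ideal.span_le]
    rintro _ ⟨k, hk, rfl⟩
    exact Ideal.mem_sup_left (Ideal.subset_span (Set.mem_insert_of_mem _ (Or.inl ⟨k, hk, rfl⟩)))

end Graph

end ChartDictionary

end Summit.ResolutionOfSingularities.ResolutionOfSingularities.Theorems.PIDim4

end
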